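import Summits.ValiantsHypothesis.ValiantsHypothesis.Theorems.GrenetZeonAlgDcQPSplit
import Summits.ValiantsHypothesis.ValiantsHypothesis.Theorems.GrenetZeonTransferToDc
import Literature.Computability.AlgebraicComplexity.AlgDetRepr
import Literature.Computability.AlgebraicComplexity.PermanentIrreducible
import Literature.Computability.AlgebraicComplexity.MignonRessayreBound
import Literature.Computability.AlgebraicComplexity.ValiantClassesProofs
import HarnessLib

/-!
# Crux `GrenetZeon.PolySizeQPAlgebra` (stmt-ValiantsHypothesis-8064), line `vbp-slice-dealg` —
the DEGREE FLOOR of the two-parameter model, the `c = 0` / `c = 1` instances of the registered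
stubs, and the SANDWICH of the piece between its `s = 1` slice and the a.e. form of DetQP's thesis

The piece `PolySizeQPAlgebra`: for every `c`, for all large `n`, `per_n` has no
`(m, s)`-representation (`HasAlgDetRepr`: an `m × m` matrix of affine linear forms over a
commutative ℂ-algebra `R` with `dim R ≤ s` and a functional reading `per_n` off `det`) with
`m ≤ n^c + c` and `s ≤ 2^((log₂ n + c)^c)`.  Registered skeleton `Lines/vbp_slice_dealg.lean`:
`stub_vbpSlice c` (`VNP ⊄ VBP` in dc form, for all large `n`) and `stub_dealgebraizePoly c`
(de-algebraization at polynomial cost in the polynomial regime); both are open-problem grade for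
general `c`.  What is settled here, unconditionally:

* `le_of_hasAlgDetRepr_perPoly` — **degree floor**: an `(m, s)`-representation of `per_n` has
  `n ≤ m`, for EVERY coefficient algebra (any `s`, nilpotents allowed): `det` of `m` affine forms has
  total degree `≤ m` over `R` (Mignon–Ressayre 2004, §1, run over `R`), so its coefficient at the
  identity-permutation monomial (degree `n > m`) is `0`, and `λ 0 = 0 ≠ 1 = coeff (per_n)`.
  Hence `not_hasAlgDetRepr_perPoly_of_lt`, `not_hasDetRepr_perPoly_of_lt`.
* the registered stubs at `c = 0` BY THE FLOOR (`stub_vbpSlice_zero`, `stub_dealgebraizePoly_zero`,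
  and the piece itself at `c = 0`, `polySizeQPAlgebra_zero`: `m ≤ n^0 + 0 = 1 < n`), and
  `stub_vbpSlice_one` (`c = 1`) by Mignon–Ressayre (`dc(per_n) ≥ n²/2 > n + 1` for `n ≥ 3`).
* the SANDWICH: `polySizeQPAlgebra_of_sliceQP` — the a.e. form of DetQP's thesis ("for every `C`,
  for all large `n`, `per_n` has no affine determinantal representation of size
  `2^((log₂ n + C)^C)`", the `s = 1` slice of the route target `AlgDcQP`) IMPLIES the whole piece,
  through the proved transfer `TransferToDc` (`(m, s) ↦ dc ≤ (s+1)(m+1)^3`, Hrubeš–Yehudayoff 2011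
  Thm. 4.2 bookkeeping, `transferToDc_proof`) and `qp · poly³ = qp`
  (`AlgDcQPSplit.log_transfer_le`, `step_base`); and `dealgebraizePoly_of_polySizeQPAlgebra` — the
  piece at `c` implies `stub_dealgebraizePoly c` (vacuity).  So, reading strength upwards,
  `VNP ⊄ VBP (a.e.) = stub_vbpSlice ≤ PolySizeQPAlgebra ≤ [dc(per_n) not quasi-polynomial, a.e.]
  ≤ AlgDcQP`, and `stub_dealgebraizePoly ≤ PolySizeQPAlgebra`: the `s`-axis piece is NOT stronger
  than the one-parameter quasi-polynomial exclusion it was split from.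

Honest framing: bookkeeping and trivial corners; the registered stubs `stub_vbpSlice c`,
`stub_dealgebraizePoly c` for `c ≥ 2` (resp. `c ≥ 1`) are open problems and are not touched.
Nothing here is progress on VP ≠ VNP.  Axioms `propext`, `Classical.choice`, `Quot.sound`.
-/

set_option linter.dupNamespace false

noncomputable section

namespace Summit.ValiantsHypothesis.ValiantsHypothesis.Theorems.GrenetZeonPolySizeQPAlgebra

open MvPolynomial Matrix
open Literature.Computability.AlgebraicComplexity
open Summit.ValiantsHypothesis.ValiantsHypothesis.Theses.GrenetZeon

/-! ### The degree floor `n ≤ m` of the two-parameter model -/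

/-- **Degree floor.** If `per_n` has an `(m, s)`-representation — over ANY commutative coefficient
algebra `R`, of any dimension `s` — then `n ≤ m`: the determinant of an `m × m` matrix of affine
linear forms over `R` has total degree `≤ m` (Mignon–Ressayre 2004, §1, `deg f ≤ dc f`, run over the
coefficient ring `R`), so for `m < n` its coefficient at the identity-permutation monomial
`∏ x_ii` (degree `n`) vanishes and `λ 0 = 0`, while that coefficient of `per_n` is `1`.
[cite: MignonRessayre2004, §1] -/
theorem le_of_hasAlgDetRepr_perPoly {n m s : ℕ} (h : HasAlgDetRepr (perPoly (Fin n) ℂ) m s) :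
    n ≤ m := by
  obtain ⟨R, _, _, _, -, l, A, hA, hf⟩ := h
  by_contra hlt
  push Not at hlt
  -- the identity-permutation monomial has coefficient `1` in `per_n` and degree `n`
  have hcoeff : MvPolynomial.coeff (permMonomial (Equiv.refl (Fin n))) (perPoly (Fin n) ℂ) = 1 :=
    coeff_permMonomial_perPoly ℂ _
  have hdeg : (permMonomial (Equiv.refl (Fin n))).degree = n := by
    by_contra hne
    have h0 := (perPoly_isHomogeneous (n := Fin n) (k := ℂ)).coeff_eq_zero
      (d := permMonomial (Equiv.refl (Fin n))) (by rwa [Fintype.card_fin])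
    rw [hcoeff] at h0
    exact one_ne_zero h0
  -- `det A` has total degree `≤ m < n` over `R`, so that coefficient of `det A` is `0`
  have hdet : A.det.totalDegree ≤ m := totalDegree_le_of_hasDetRepr_holds ⟨A, hA, rfl⟩
  have hzero : MvPolynomial.coeff (permMonomial (Equiv.refl (Fin n))) A.det = 0 := by
    apply coeff_eq_zero_of_totalDegree_lt
    rw [← Finsupp.degree_apply, hdeg]
    exact lt_of_le_of_lt hdet hlt
  have h1 := hf (permMonomial (Equiv.refl (Fin n)))
  rw [hzero, map_zero, hcoeff] at h1
  exact zero_ne_one h1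

/-- Below the degree floor there is no `(m, s)`-representation of `per_n`: `m < n` excludes every
`s` and every coefficient algebra. [cite: MignonRessayre2004, §1] -/
theorem not_hasAlgDetRepr_perPoly_of_lt {n m s : ℕ} (h : m < n) :
    ¬ HasAlgDetRepr (perPoly (Fin n) ℂ) m s :=
  fun hrep => absurd (le_of_hasAlgDetRepr_perPoly hrep) (not_le.mpr h)

/-- Below the degree floor there is no affine determinantal representation of `per_n` over `ℂ`
(`deg per_n = n ≤ dc(per_n)`; the `s = 1` slice of `not_hasAlgDetRepr_perPoly_of_lt`).
[cite: MignonRessayre2004, §1] -/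
theorem not_hasDetRepr_perPoly_of_lt {n m : ℕ} (h : m < n) : ¬ HasDetRepr (perPoly (Fin n) ℂ) m :=
  fun hrep => not_hasAlgDetRepr_perPoly_of_lt (s := 1) h hrep.hasAlgDetRepr

/-! ### The registered stubs at `c = 0` and `c = 1` -/

/-- `stub_vbpSlice` at `c = 0`, PROVED by the degree floor: `n^0 + 0 = 1 < n` for `n ≥ 2`.
[cite: MignonRessayre2004, §1] -/
theorem stub_vbpSlice_zero : ∃ n₀ : ℕ, ∀ n ≥ n₀, ¬ HasDetRepr (perPoly (Fin n) ℂ) (n ^ 0 + 0) :=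
  ⟨2, fun n hn => not_hasDetRepr_perPoly_of_lt (by rw [pow_zero]; omega)⟩

/-- `stub_vbpSlice` at `c = 1`, PROVED by Mignon–Ressayre: `dc(per_n) ≥ n²/2 > n + 1` for `n ≥ 3`
(`sq_le_two_mul_determinantalComplexity_perPoly_complex_holds`; the skeleton's BC5 witness
`vbpSlice_one`). [cite: MignonRessayre2004, Thm. 1.1] -/
theorem stub_vbpSlice_one : ∃ n₀ : ℕ, ∀ n ≥ n₀, ¬ HasDetRepr (perPoly (Fin n) ℂ) (n ^ 1 + 1) := by
  refine ⟨3, fun n hn h => ?_⟩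
  have h1 : n ^ 2 ≤ 2 * determinantalComplexity (perPoly (Fin n) ℂ) :=
    sq_le_two_mul_determinantalComplexity_perPoly_complex_holds hn
  have h2 : determinantalComplexity (perPoly (Fin n) ℂ) ≤ n ^ 1 + 1 :=
    determinantalComplexity_le_of_hasDetRepr h
  have h3 : n * n ≤ 2 * (n + 1) := by
    calc n * n = n ^ 2 := (sq n).symm
      _ ≤ 2 * (n ^ 1 + 1) := h1.trans (Nat.mul_le_mul_left 2 h2)
      _ = 2 * (n + 1) := by rw [pow_one]
  nlinarith

/-- `stub_dealgebraizePoly` at `c = 0`, PROVED (vacuously) by the degree floor: an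
`(m, s)`-representation with `m ≤ n^0 + 0 = 1` does not exist for `n ≥ 2`. [cite: MignonRessayre2004, §1] -/
theorem stub_dealgebraizePoly_zero :
    ∃ k n₀ : ℕ, ∀ n ≥ n₀, ∀ m s : ℕ, m ≤ n ^ 0 + 0 → s ≤ 2 ^ ((Nat.log 2 n + 0) ^ 0) →
      HasAlgDetRepr (perPoly (Fin n) ℂ) m s → HasDetRepr (perPoly (Fin n) ℂ) (n ^ k + k) :=
  ⟨0, 2, fun n hn m s hm _ h =>
    absurd h (not_hasAlgDetRepr_perPoly_of_lt (by rw [pow_zero] at hm; omega))⟩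

/-- The piece `PolySizeQPAlgebra` at `c = 0`, PROVED by the degree floor: for `n ≥ 2` there is no
`(m, s)`-representation of `per_n` with `m ≤ n^0 + 0 = 1`, whatever `s` (the route statement
inlines `HasAlgDetRepr`, `hasAlgDetRepr_iff`). [cite: MignonRessayre2004, §1] -/
theorem polySizeQPAlgebra_zero :
    ∃ n₀ : ℕ, ∀ n ≥ n₀, ∀ m s : ℕ, m ≤ n ^ 0 + 0 → s ≤ 2 ^ ((Nat.log 2 n + 0) ^ 0) →
      ¬ HasAlgDetRepr (perPoly (Fin n) ℂ) m s :=
  ⟨2, fun n hn m s hm _ => not_hasAlgDetRepr_perPoly_of_lt (by rw [pow_zero] at hm; omega)⟩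

/-! ### The sandwich: `stub_dealgebraizePoly ≤ PolySizeQPAlgebra ≤ (dc(per_n) not qp, a.e.)` -/

/-- `stub_dealgebraizePoly c` is implied by the piece at the same `c` (vacuity: the piece says the
hypothesis `HasAlgDetRepr (per_n) m s` of the stub is never met in the box, for large `n`).
[folklore] -/
theorem dealgebraizePoly_of_polySizeQPAlgebra (c : ℕ)
    (hP : ∃ n₀ : ℕ, ∀ n ≥ n₀, ∀ m s : ℕ, m ≤ n ^ c + c → s ≤ 2 ^ ((Nat.log 2 n + c) ^ c) →
      ¬ HasAlgDetRepr (perPoly (Fin n) ℂ) m s) :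
    ∃ k n₀ : ℕ, ∀ n ≥ n₀, ∀ m s : ℕ, m ≤ n ^ c + c → s ≤ 2 ^ ((Nat.log 2 n + c) ^ c) →
      HasAlgDetRepr (perPoly (Fin n) ℂ) m s → HasDetRepr (perPoly (Fin n) ℂ) (n ^ k + k) := by
  obtain ⟨n₀, h⟩ := hP
  exact ⟨0, n₀, fun n hn m s hm hs hrep => absurd hrep (h n hn m s hm hs)⟩

/-- Arithmetic of the transfer: inside the box `m ≤ n^c + c`, `s ≤ 2^((log₂ n + c)^c)` the
transfer size `(s+1)(m+1)^3` is at most `2^((log₂ n + C)^C)` for a constant `C` depending only on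
`c` (`n^c + c ≤ 2^((log₂ n + k)^k)`, `IsPBounded.isQPBounded`; then `AlgDcQPSplit.log_transfer_le`
and `step_base`). [folklore] -/
theorem exists_transfer_le_qexp (c : ℕ) :
    ∃ C : ℕ, ∀ n m s : ℕ, m ≤ n ^ c + c → s ≤ 2 ^ ((Nat.log 2 n + c) ^ c) →
      (s + 1) * (m + 1) ^ 3 ≤ 2 ^ ((Nat.log 2 n + C) ^ C) := by
  obtain ⟨k, hk⟩ := IsPBounded.isQPBounded (t := fun n => n ^ c + c) ⟨c, fun n => le_rfl⟩
  refine ⟨max c k + 9, fun n m s hm hs => ?_⟩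
  set L := Nat.log 2 n with hL
  set c' := max c k with hc'
  have hm' : m ≤ 2 ^ ((L + c') ^ c') :=
    hm.trans ((hk n).trans (Nat.pow_le_pow_right Nat.two_pos
      (IsQPBounded.qexp_mono L (le_max_right c k))))
  have hs' : s ≤ 2 ^ ((L + c') ^ c') :=
    hs.trans (Nat.pow_le_pow_right Nat.two_pos (IsQPBounded.qexp_mono L (le_max_left c k)))
  have hlog : Nat.log 2 ((s + 1) * (m + 1) ^ 3) ≤ 4 * (L + c') ^ c' + 4 :=
    GrenetZeon.AlgDcQPSplit.log_transfer_le L c' m s hm' hs'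
  have hbase : 4 * (L + c') ^ c' + 4 + 1 ≤ (L + c' + 1 + 8) ^ (c' + 1) :=
    GrenetZeon.AlgDcQPSplit.step_base L c' 1
  calc (s + 1) * (m + 1) ^ 3
      ≤ 2 ^ (Nat.log 2 ((s + 1) * (m + 1) ^ 3) + 1) :=
        (Nat.lt_pow_succ_log_self Nat.one_lt_two _).le
    _ ≤ 2 ^ ((L + c' + 1 + 8) ^ (c' + 1)) :=
        Nat.pow_le_pow_right Nat.two_pos ((Nat.add_le_add_right hlog 1).trans hbase)
    _ = 2 ^ ((L + (c' + 9)) ^ (c' + 1)) := by rw [show L + c' + 1 + 8 = L + (c' + 9) by ring]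
    _ ≤ 2 ^ ((L + (c' + 9)) ^ (c' + 9)) :=
        Nat.pow_le_pow_right Nat.two_pos (Nat.pow_le_pow_right (by omega) (by omega))

/-- **The piece is implied by the a.e. form of DetQP's thesis.** If for every `C`, for all large
`n`, `per_n` has no affine determinantal representation of size `2^((log₂ n + C)^C)` (the `s = 1`
slice of the route target `AlgDcQP`), then `PolySizeQPAlgebra` holds: an `(m, s)`-representation in
the box transfers (`TransferToDc`, proved: `dc ≤ (s+1)(m+1)^3`, Hrubeš–Yehudayoff 2011 Thm. 4.2 /
Mahajan–Vinay bookkeeping) to an affine representation of size `≤ 2^((log₂ n + C)^C)`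
(`exists_transfer_le_qexp`, padding `HasDetRepr.mono`), excluded for large `n`.
[cite: HrubesYehudayoff2011, Thm. 4.2] -/
theorem polySizeQPAlgebra_of_sliceQP
    (hslice : ∀ C : ℕ, ∃ n₀ : ℕ, ∀ n ≥ n₀,
      ¬ HasDetRepr (perPoly (Fin n) ℂ) (2 ^ ((Nat.log 2 n + C) ^ C))) :
    PolySizeQPAlgebra := by
  intro c
  obtain ⟨C, hC⟩ := exists_transfer_le_qexp c
  obtain ⟨n₀, hn₀⟩ := hslice C
  refine ⟨n₀, fun n hn m s hm hs hrep => hn₀ n hn ?_⟩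
  have hdc : HasDetRepr (perPoly (Fin n) ℂ) ((s + 1) * (m + 1) ^ 3) :=
    GrenetZeon.transferToDc_proof n m s hrep
  exact HasDetRepr.mono_holds hdc (hC n m s hm hs)

/-- **`stub_dealgebraizePoly` (every `c`) is implied by the a.e. form of DetQP's thesis** — the
registered stub sits below the one-parameter quasi-polynomial exclusion: combine
`polySizeQPAlgebra_of_sliceQP` with `dealgebraizePoly_of_polySizeQPAlgebra`.
[cite: HrubesYehudayoff2011, Thm. 4.2] -/
theorem dealgebraizePoly_of_sliceQP
    (hslice : ∀ C : ℕ, ∃ n₀ : ℕ, ∀ n ≥ n₀,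
      ¬ HasDetRepr (perPoly (Fin n) ℂ) (2 ^ ((Nat.log 2 n + C) ^ C))) (c : ℕ) :
    ∃ k n₀ : ℕ, ∀ n ≥ n₀, ∀ m s : ℕ, m ≤ n ^ c + c → s ≤ 2 ^ ((Nat.log 2 n + c) ^ c) →
      HasAlgDetRepr (perPoly (Fin n) ℂ) m s → HasDetRepr (perPoly (Fin n) ℂ) (n ^ k + k) :=
  dealgebraizePoly_of_polySizeQPAlgebra c (polySizeQPAlgebra_of_sliceQP hslice c)

/-- **The `s = 1` slice of the piece is `stub_vbpSlice`**: `PolySizeQPAlgebra` implies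
`VNP ⊄ VBP` in dc form for all large `n` (take `s = 1 ≤ 2^((log₂ n + c)^c)`, `R = ℂ`, `λ = id`,
`HasDetRepr.hasAlgDetRepr`). [cite: MignonRessayre2004, §1] -/
theorem vbpSlice_of_polySizeQPAlgebra (hP : PolySizeQPAlgebra) (c : ℕ) :
    ∃ n₀ : ℕ, ∀ n ≥ n₀, ¬ HasDetRepr (perPoly (Fin n) ℂ) (n ^ c + c) := by
  obtain ⟨n₀, h⟩ := hP c
  exact ⟨n₀, fun n hn hdet => h n hn (n ^ c + c) 1 le_rfl Nat.one_le_two_pow hdet.hasAlgDetRepr⟩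

/-! ### Appendix (2026-08-31): the piece below the route target and above the printed conjecture -/

/-- **The piece is implied by the route target directly.** `AlgDcQP → PolySizeQPAlgebra`: the
polynomial box `m ≤ n^c + c` sits inside the quasi-polynomial box `m ≤ 2^((log₂ n + C)^C)` for a
constant `C ≥ c` depending only on `c` (`IsPBounded.isQPBounded`, `IsQPBounded.qexp_mono`), and the
excluded `∃`-statement is the same.  (So in the decomposition
`AlgDcQP ⇐ TransferToDc ∧ AbelianizationQP ∧ PolySizeQPAlgebra` this piece is NECESSARY.)
[cite: BurgisserClausenShokrollahi1997, Def. (21.31) and remark, p. 562] -/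
theorem polySizeQPAlgebra_of_algDcQP (hA : AlgDcQP) : PolySizeQPAlgebra := by
  intro c
  obtain ⟨k, hk⟩ := IsPBounded.isQPBounded (t := fun n => n ^ c + c) ⟨c, fun n => le_rfl⟩
  obtain ⟨n₀, h⟩ := hA (max c k)
  refine ⟨n₀, fun n hn m s hm hs => h n hn m s ?_ ?_⟩
  · exact hm.trans ((hk n).trans (Nat.pow_le_pow_right Nat.two_pos
      (IsQPBounded.qexp_mono (Nat.log 2 n) (le_max_right c k))))
  · exact hs.trans (Nat.pow_le_pow_right Nat.two_pos
      (IsQPBounded.qexp_mono (Nat.log 2 n) (le_max_left c k)))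

/-- `stub_vbpSlice c` in dc language: "eventually `¬ HasDetRepr (per_n) (n^c + c)`" is
"eventually `n^c + c < dc(per_n)`" (`HasDetRepr f m ↔ dc f ≤ m`,
`hasDetRepr_iff_determinantalComplexity_le_holds`). [cite: MignonRessayre2004, §1] -/
theorem vbpSlice_iff_dc (c : ℕ) :
    (∃ n₀ : ℕ, ∀ n ≥ n₀, ¬ HasDetRepr (perPoly (Fin n) ℂ) (n ^ c + c)) ↔
      ∃ n₀ : ℕ, ∀ n ≥ n₀, n ^ c + c < determinantalComplexity (perPoly (Fin n) ℂ) := by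
  refine exists_congr fun n₀ => forall_congr' fun n => forall_congr' fun _ => ?_
  rw [hasDetRepr_iff_determinantalComplexity_le_holds, not_le]

/-- **All slices together imply the printed conjecture.** `(∀ c, stub_vbpSlice c)` — `VNP ⊄ VBP`
in dc form FOR ALL LARGE `n` — implies `DcPerSuperpolynomial ℂ`, i.e. `dc(per_n)` is not
p-bounded (Mulmuley–Sohoni / Bürgisser's `VNP ⊄ VP_ws` in dc form, an "infinitely often"
statement): a p-bound `dc(per_n) ≤ n^c + c` for all `n` is refuted at `n = n₀(c)`.  The converse
(i.o. ⟹ a.e.) is not claimed. [cite: Burgisser2000, Def. 2.1(1)] -/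
theorem dcPerSuperpolynomial_of_vbpSlice
    (h : ∀ c : ℕ, ∃ n₀ : ℕ, ∀ n ≥ n₀, ¬ HasDetRepr (perPoly (Fin n) ℂ) (n ^ c + c)) :
    DcPerSuperpolynomial ℂ := by
  rw [dcPerSuperpolynomial_iff]
  rintro ⟨c, hc⟩
  obtain ⟨n₀, hn₀⟩ := h c
  exact hn₀ n₀ le_rfl ((hasDetRepr_iff_determinantalComplexity_le_holds _ _).mpr (hc n₀))

/-- **The piece implies the printed conjecture** `DcPerSuperpolynomial ℂ` (`VNP ⊄ VP_ws` in dc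
form), through its `s = 1` slice (`vbpSlice_of_polySizeQPAlgebra`, `dcPerSuperpolynomial_of_vbpSlice`).
Reading strength upwards: `DcPerSuperpolynomial ℂ ≤ (∀ c, stub_vbpSlice c) ≤ PolySizeQPAlgebra ≤
[dc(per_n) not quasi-polynomial, a.e.] ≤ AlgDcQP`. [cite: Burgisser2000, Def. 2.1(1)] -/
theorem dcPerSuperpolynomial_of_polySizeQPAlgebra (hP : PolySizeQPAlgebra) :
    DcPerSuperpolynomial ℂ :=
  dcPerSuperpolynomial_of_vbpSlice (vbpSlice_of_polySizeQPAlgebra hP)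

/-- **The route target implies the printed conjecture** (`AlgDcQP → DcPerSuperpolynomial ℂ`),
composing `polySizeQPAlgebra_of_algDcQP` and `dcPerSuperpolynomial_of_polySizeQPAlgebra`; compare the
route's `SliceToDetqp` (`AlgDcQP → ¬ IsQPBounded dc(per_n)`, the stronger quasi-polynomial form).
[cite: Burgisser2000, Def. 2.1(1)] -/
theorem dcPerSuperpolynomial_of_algDcQP (hA : AlgDcQP) : DcPerSuperpolynomial ℂ :=
  dcPerSuperpolynomial_of_polySizeQPAlgebra (polySizeQPAlgebra_of_algDcQP hA)

/-! ### Appendix B (2026-08-31): the route target IS its `s = 1` slice; given the abelianization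
crux, the piece IS the target -/

/-- Arithmetic of the transfer inside the quasi-polynomial box: for `m, s ≤ 2^((log₂ n + c)^c)` the
transfer size `(s+1)(m+1)^3` is at most `2^((log₂ n + (c + 9))^(c + 9))`
(`AlgDcQPSplit.log_transfer_le`, `step_base`). [folklore] -/
theorem transfer_le_qexp_of_qexp {n c m s : ℕ} (hm : m ≤ 2 ^ ((Nat.log 2 n + c) ^ c))
    (hs : s ≤ 2 ^ ((Nat.log 2 n + c) ^ c)) :
    (s + 1) * (m + 1) ^ 3 ≤ 2 ^ ((Nat.log 2 n + (c + 9)) ^ (c + 9)) := by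
  set L := Nat.log 2 n with hL
  have hlog : Nat.log 2 ((s + 1) * (m + 1) ^ 3) ≤ 4 * (L + c) ^ c + 4 :=
    GrenetZeon.AlgDcQPSplit.log_transfer_le L c m s hm hs
  have hbase : 4 * (L + c) ^ c + 4 + 1 ≤ (L + c + 1 + 8) ^ (c + 1) :=
    GrenetZeon.AlgDcQPSplit.step_base L c 1
  calc (s + 1) * (m + 1) ^ 3
      ≤ 2 ^ (Nat.log 2 ((s + 1) * (m + 1) ^ 3) + 1) :=
        (Nat.lt_pow_succ_log_self Nat.one_lt_two _).le
    _ ≤ 2 ^ ((L + c + 1 + 8) ^ (c + 1)) :=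
        Nat.pow_le_pow_right Nat.two_pos ((Nat.add_le_add_right hlog 1).trans hbase)
    _ = 2 ^ ((L + (c + 9)) ^ (c + 1)) := by rw [show L + c + 1 + 8 = L + (c + 9) by ring]
    _ ≤ 2 ^ ((L + (c + 9)) ^ (c + 9)) :=
        Nat.pow_le_pow_right Nat.two_pos (Nat.pow_le_pow_right (by omega) (by omega))

/-- **The route target is equivalent to its `s = 1` slice** (the a.e. form of DetQP's thesis:
for every `C`, for all large `n`, `per_n` has no affine determinantal representation of size
`2^((log₂ n + C)^C)`).  Forward: an affine representation is an `(m, 1)`-representation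
(`HasDetRepr.hasAlgDetRepr`, `1 ≤ 2^e`).  Backward: an `(m, s)`-representation in the
quasi-polynomial box transfers (`TransferToDc`, proved: `transferToDc_proof`) to an affine one of
size `(s+1)(m+1)^3 ≤ 2^((log₂ n + (c+9))^(c+9))` (`transfer_le_qexp_of_qexp`, padding
`HasDetRepr.mono`).  So the coefficient-algebra axis adds nothing to the TARGET; it enters only
through the pieces. [cite: HrubesYehudayoff2011, Thm. 4.2] -/
theorem algDcQP_iff_sliceQP :
    AlgDcQP ↔ ∀ C : ℕ, ∃ n₀ : ℕ, ∀ n ≥ n₀,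
      ¬ HasDetRepr (perPoly (Fin n) ℂ) (2 ^ ((Nat.log 2 n + C) ^ C)) := by
  constructor
  · intro hA C
    obtain ⟨n₀, h⟩ := hA C
    exact ⟨n₀, fun n hn hdet =>
      h n hn (2 ^ ((Nat.log 2 n + C) ^ C)) 1 le_rfl Nat.one_le_two_pow hdet.hasAlgDetRepr⟩
  · intro hslice c
    obtain ⟨n₀, hn₀⟩ := hslice (c + 9)
    refine ⟨n₀, fun n hn m s hm hs hrep => hn₀ n hn ?_⟩
    have hdc : HasDetRepr (perPoly (Fin n) ℂ) ((s + 1) * (m + 1) ^ 3) :=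
      GrenetZeon.transferToDc_proof n m s hrep
    exact HasDetRepr.mono_holds hdc (transfer_le_qexp_of_qexp hm hs)

/-- **Given the abelianization crux, the piece IS the target**: `AbelianizationQP` implies
`AlgDcQP ↔ PolySizeQPAlgebra` (`→`: `polySizeQPAlgebra_of_algDcQP`, unconditionally; `←`: the
proved split `AlgDcQPSplit.AlgDcQP_of_subs` with `transferToDc_proof`).  Reading: the line
`vbp-slice-dealg` attacks, modulo `AbelianizationQP`, exactly the route target in disguise.
[cite: HrubesYehudayoff2011, Thm. 4.2] -/
theorem algDcQP_iff_polySizeQPAlgebra_of_abelianizationQP (hAb : AbelianizationQP) :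
    AlgDcQP ↔ PolySizeQPAlgebra :=
  ⟨polySizeQPAlgebra_of_algDcQP,
    GrenetZeon.AlgDcQPSplit.AlgDcQP_of_subs GrenetZeon.transferToDc_proof hAb⟩

end Summit.ValiantsHypothesis.ValiantsHypothesis.Theorems.GrenetZeonPolySizeQPAlgebra

end
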